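import Summits.AtomisticToContinuum.Crystallization.Theorems.FrustratedLawDichotomyMotifLemmas

/-!
# `GoodCollar` — the configuration-space COLLAR of the two-shell fit predicate (lens-5 node 89 «FatCore», 27623 `(H) HomFloor (1/625)`)

decomp-a2c lens-5 gen 89 (crux `AperiodicFrustratedLawGap`, stmt-AtomisticToContinuum-27623; residual of record «(H) HomFloor» of
`…StrainedPatchHomSplit`, door of record node 88 `…HomEntrySemanticQuot.homFloor_of_entryTree6RBKP4_semOKHQ`).

THE LEMMA (pure triangle inequalities, [folklore]).  If the site `i` of a cluster `y` is pattern-GOOD WITH EXPOSED PARAMETERS — fit scale `d`,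
residual level `η'` (all twelve template residuals `≤ η'·d`), clean-gap margin `γ` (`GoodWith D y i d η' γ`, §1: the text of
`…MotifLemmas.GoodAtScale` with the three leading existentials pulled out and the template given by indices) — and `y'` is ANY cluster on the
same index set whose atoms near the centre moved by at most `ρ` RELATIVE TO THE CENTRE (`‖(y' a − y' i) − (y a − y i)‖ ≤ ρ` for the atoms
with `dist (y a) (y i) < 13/10·d + γ`, the far ones staying outside `13/10·d + γ − ρ`), then `i` is good in `y'` with parameters
`d' = nn'_i ∈ [d − ρ, d + ρ]`, `η'' = (η'·d + 2ρ)/(d − ρ)`, `γ' = γ − 23/10·ρ` (★ `GoodWith.perturb`), hence (★★ `goodAtScale_of_goodWith_perturb`)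

  `η'·d + 2ρ < ηmax·(d − ρ)`, `23/10·ρ < γ`, `d + ρ ≤ D'`  ⟹  `GoodAtScale ηmax D' y' i`.

WHY IT IS HERE (memo `NODE-g89.md`).  In the `(H)` certificate of record a T column's CORE is the slab leaf `…HomEntryLeafHTA2Q` = goodness on the
thin sheet slab (radii `(2.5, 3.1, 0.94)e-3`) + force-exemption on the rest of the cell (`V1+V2`, `≈ 2/3` of the core's kernel time), and the exterior
chain attaches at the T-face `(3.0–3.75, 1.35)e-3`.  The collar law says the goodness certificate ALONE, run with threshold `η₀ < 1/20`, covers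
every shuffle within `ρ = d(1/20 − η₀)/(41/20)` of the slab IN EVERY ξ-DIRECTION (the «stiff» axis is stiff for the force, not for the misfit):
at `t ≤ 0.75·t_b` (≈ 98 % of the T columns of BUDGET8) `ρ ≈ 4–10e-3` ≫ the `0.5–0.65e-3` shell that `V1+V2` certify, so the slab-exempt pieces
retire there and the exterior chain starts `2–4×` further out (probe FATSLAB, memo §2).  The lemma is the analytic half («asymptotic regime»);
the finite range `t ∈ (0.75, 0.85]·t_b` keeps the slab design of record; the bridge is the margin law `ρ(t)`.

CONTENTS.  §1 `FitWith v y i d η' γ` (pattern-generic, index-form clause list), `GoodWith D y i d η' γ`, `GoodWith.goodAtScale`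
(repackaging into the tree's `GoodAtScale`, verbatim text).  §2 ★ `FitWith.perturb` (the collar, generic in the pattern), ★ `GoodWith.perturb`.
§3 ★★ `goodAtScale_of_goodWith_perturb` (closed-form side conditions) and its global-displacement corollary `goodAtScale_of_goodWith_shift`
(every atom moved `≤ ρ` relative to the centre — the shape of a ξ-move `ξ₀ ↦ ξ` of the homogeneous two-sublattice cluster, where the
B-sublattice atoms move by `U(ξ − ξ₀)` and the A-atoms not at all).  §4 `clauses_smul`, ★ `goodAtScale_smul` — the DILATION CONE: the tree's
`GoodAtScale` is exactly covariant under `y ↦ λ·y` (`λ > 0`; cap `D ↦ λD`), so a goodness-only core certificate on a cell-matrix box `B` serves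
every column in the cone `{λU}` (memo §5 «ConeString»: the ≈ 5 columns of a dilation string share ONE core certificate).

0 sorry; standard axioms; no instances / notation / `#eval`; no kernel certificates.  To be landed `--supports stmt-AtomisticToContinuum-27623`.
-/

noncomputable section

namespace Summit.AtomisticToContinuum.Crystallization.Theorems.FrustratedLawDichotomyStrainedPatchHomGoodCollar

open scoped BigOperators
open Literature.Geometry.DiscreteGeometry (nearestDist nearestDist_le_dist le_nearestDist exists_nearestDist_eq_dist
  fccKissingPattern hcpKissingPattern norm_eq_one_of_mem_fccKissingPattern norm_eq_one_of_mem_hcpKissingPattern)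
open Summit.AtomisticToContinuum.Crystallization.Theorems.ChargedEnergyGapNegative (E3)
open Summit.AtomisticToContinuum.Crystallization.Theorems.FrustratedLawDichotomyMotifLemmas (GoodAtScale)

/-! ## §1. The fit predicate with exposed parameters -/

/-- **`FitWith v y i d η' γ`** — the clause list of the two-shell fit predicate for the pattern `v : P → E3`, with the fit scale `d`, the residual
level `η'` and the clean-gap margin `γ` EXPOSED and the template given by indices `τ : P → Fin N` (index form of the body of `GoodAt`/`GoodAtScale`). -/
def FitWith {P : Type*} (v : P → E3) {N : ℕ} (y : Fin N → E3) (i : Fin N) (d η' γ : ℝ) : Prop :=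
  ∃ (A : E3 →ₗᵢ[ℝ] E3) (τ : P → Fin N), 0 < d ∧ 0 < γ ∧ (∀ u, ‖(y (τ u) - y i) - d • A (v u)‖ ≤ η' * d) ∧
    (∀ a, a ≠ i → d ≤ dist (y a) (y i)) ∧ (∃ a, a ≠ i ∧ dist (y a) (y i) ≤ d) ∧
    (∀ a, a ≠ i → dist (y a) (y i) < 13 / 10 * d + γ → dist (y a) (y i) ≤ 13 / 10 * d - γ ∧ a ∈ Set.range τ)

/-- **`GoodWith D y i d η' γ`** — `GoodAtScale · D y i` with exposed parameters: scale cap `d ≤ D` and the fcc- or hcp-pattern clause list. -/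
def GoodWith (D : ℝ) {N : ℕ} (y : Fin N → E3) (i : Fin N) (d η' γ : ℝ) : Prop :=
  d ≤ D ∧ (FitWith (fun u : ↥fccKissingPattern => (u : E3)) y i d η' γ ∨ FitWith (fun u : ↥hcpKissingPattern => (u : E3)) y i d η' γ)

/-- Index-form clauses give the point-set clauses of `GoodAt`/`GoodAtScale` (template `t = y ∘ τ`). [folklore] -/
theorem FitWith.pointClauses {P : Type*} {v : P → E3} {N : ℕ} {y : Fin N → E3} {i : Fin N} {d η' γ ηmax : ℝ}
    (hyi : ∀ a, a ≠ i → y a ≠ y i) (h : FitWith v y i d η' γ) (hη : η' < ηmax) :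
    ∃ (A : E3 →ₗᵢ[ℝ] E3) (t : P → E3), 0 < d ∧ 0 < γ ∧ η' < ηmax ∧ (∀ u, t u ∈ Set.range y ∧ ‖(t u - y i) - d • A (v u)‖ ≤ η' * d) ∧
      (∀ s, s ∈ Set.range y → s ≠ y i → d ≤ dist s (y i)) ∧ (∃ s, s ∈ Set.range y ∧ s ≠ y i ∧ dist s (y i) ≤ d) ∧
      (∀ s, s ∈ Set.range y → s ≠ y i → dist s (y i) < 13 / 10 * d + γ → dist s (y i) ≤ 13 / 10 * d - γ ∧ s ∈ Set.range t) := by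
  obtain ⟨A, τ, hd, hγ, hres, hnn, ⟨a₀, ha₀, ha₀d⟩, hgap⟩ := h
  refine ⟨A, y ∘ τ, hd, hγ, hη, fun u => ⟨⟨τ u, rfl⟩, hres u⟩, ?_, ⟨y a₀, ⟨a₀, rfl⟩, hyi a₀ ha₀, ha₀d⟩, ?_⟩
  · rintro s ⟨a, rfl⟩ hs
    exact hnn a fun h => hs (by rw [h])
  · rintro s ⟨a, rfl⟩ hs hlt
    obtain ⟨h1, u, hu⟩ := hgap a (fun h => hs (by rw [h])) hlt
    exact ⟨h1, u, by simp [Function.comp, hu]⟩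

/-- ★ `GoodWith` repackages into the tree's `GoodAtScale` (any tolerance `ηmax > η'`). [folklore] -/
theorem GoodWith.goodAtScale {D : ℝ} {N : ℕ} {y : Fin N → E3} {i : Fin N} {d η' γ ηmax : ℝ}
    (hyi : ∀ a, a ≠ i → y a ≠ y i) (h : GoodWith D y i d η' γ) (hη : η' < ηmax) : GoodAtScale ηmax D y i := by
  obtain ⟨hdD, hor⟩ := h
  rcases hor with hf | hh
  · obtain ⟨A, t, hcl⟩ := hf.pointClauses hyi hη
    exact ⟨d, η', γ, A, hdD, Or.inl ⟨t, hcl⟩⟩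
  · obtain ⟨A, t, hcl⟩ := hh.pointClauses hyi hη
    exact ⟨d, η', γ, A, hdD, Or.inr ⟨t, hcl⟩⟩

/-! ## §2. The collar: perturbing the clause list -/

/-- Displacement `≤ ρ` relative to the centre moves the distance to the centre by at most `ρ`. [folklore] -/
theorem dist_perturb {N : ℕ} {y y' : Fin N → E3} {i a : Fin N} {ρ : ℝ} (h : ‖(y' a - y' i) - (y a - y i)‖ ≤ ρ) :
    dist (y a) (y i) - ρ ≤ dist (y' a) (y' i) ∧ dist (y' a) (y' i) ≤ dist (y a) (y i) + ρ := by
  rw [dist_eq_norm, dist_eq_norm]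
  have h1 := norm_sub_norm_le (y a - y i) (y' a - y' i)
  have h2 := norm_sub_norm_le (y' a - y' i) (y a - y i)
  rw [norm_sub_rev (y a - y i) (y' a - y' i)] at h1
  constructor <;> linarith

/-- ★ **THE COLLAR** (pattern-generic).  Goodness with exposed parameters at `y` and displacements `≤ ρ` relative to the centre (near atoms; far
atoms stay outside `13/10·d + γ − ρ`) give goodness at `y'` with scale `nn'_i ∈ [d − ρ, d + ρ]`, residual level `(η'·d + 2ρ)/(d − ρ)` and
clean-gap margin `γ − 23/10·ρ`; also every other atom of `y'` stays off the centre. [folklore] -/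
theorem FitWith.perturb {P : Type*} {v : P → E3} (hv : ∀ u, ‖v u‖ = 1) {N : ℕ} {y y' : Fin N → E3} {i : Fin N} {d η' γ ρ : ℝ}
    (h : FitWith v y i d η' γ) (hη0 : 0 ≤ η') (hη3 : η' < 3 / 10) (hρ0 : 0 ≤ ρ) (hργ : 23 / 10 * ρ < γ) (hρd : ρ < d)
    (hnear : ∀ a, dist (y a) (y i) < 13 / 10 * d + γ → ‖(y' a - y' i) - (y a - y i)‖ ≤ ρ)
    (hfar : ∀ a, a ≠ i → 13 / 10 * d + γ ≤ dist (y a) (y i) → 13 / 10 * d + γ - ρ ≤ dist (y' a) (y' i)) :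
    d - ρ ≤ nearestDist y' i ∧ nearestDist y' i ≤ d + ρ ∧ (∀ a, a ≠ i → y' a ≠ y' i) ∧
      FitWith v y' i (nearestDist y' i) ((η' * d + 2 * ρ) / (d - ρ)) (γ - 23 / 10 * ρ) := by
  obtain ⟨A, τ, hd, hγ, hres, hnn, ⟨a₀, ha₀, ha₀d⟩, hgap⟩ := h
  -- every other atom of `y'` is at distance `≥ d − ρ` from the centre
  have hlow : ∀ a, a ≠ i → d - ρ ≤ dist (y' a) (y' i) := by
    intro a ha
    by_cases hlt : dist (y a) (y i) < 13 / 10 * d + γ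
    · have := (dist_perturb (hnear a hlt)).1
      have := hnn a ha
      linarith
    · push Not at hlt
      have := hfar a ha hlt
      linarith
  have hd'lo : d - ρ ≤ nearestDist y' i :=
    le_nearestDist ⟨a₀, ha₀⟩ fun k hk => by rw [dist_comm]; exact hlow k hk
  have ha₀near : dist (y a₀) (y i) < 13 / 10 * d + γ := by linarith
  have hd'hi : nearestDist y' i ≤ d + ρ := by
    have h1 := nearestDist_le_dist y' ha₀
    rw [dist_comm] at h1
    have h2 := (dist_perturb (hnear a₀ ha₀near)).2
    linarith
  have hd'pos : 0 < nearestDist y' i := by linarith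
  have hoff : ∀ a, a ≠ i → y' a ≠ y' i := by
    intro a ha h
    have := hlow a ha
    rw [h, dist_self] at this
    linarith
  refine ⟨hd'lo, hd'hi, hoff, A, τ, hd'pos, by linarith, fun u => ?_, fun a ha => ?_, ?_, fun a ha hlt => ?_⟩
  · -- residuals: `≤ η'·d + ρ + |d − d'| ≤ η'·d + 2ρ ≤ η''·d'`
    have hτnear : dist (y (τ u)) (y i) < 13 / 10 * d + γ := by
      rw [dist_eq_norm]
      have h1 : ‖y (τ u) - y i‖ ≤ ‖(y (τ u) - y i) - d • A (v u)‖ + ‖d • A (v u)‖ := by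
        have := norm_add_le ((y (τ u) - y i) - d • A (v u)) (d • A (v u))
        rwa [sub_add_cancel] at this
      have h2 : ‖d • A (v u)‖ = d := by
        rw [norm_smul, LinearIsometry.norm_map, hv u, mul_one, Real.norm_eq_abs, abs_of_pos hd]
      have h3 := hres u
      nlinarith
    have hdisp := hnear (τ u) hτnear
    have hdd : |d - nearestDist y' i| ≤ ρ := abs_sub_le_iff.2 ⟨by linarith, by linarith⟩
    have hsplit : (y' (τ u) - y' i) - nearestDist y' i • A (v u) =
        ((y (τ u) - y i) - d • A (v u)) + ((y' (τ u) - y' i) - (y (τ u) - y i)) + (d - nearestDist y' i) • A (v u) := by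
      rw [sub_smul]; abel
    have hn3 : ‖(d - nearestDist y' i) • A (v u)‖ = |d - nearestDist y' i| := by
      rw [norm_smul, LinearIsometry.norm_map, hv u, mul_one, Real.norm_eq_abs]
    have hbound : ‖(y' (τ u) - y' i) - nearestDist y' i • A (v u)‖ ≤ η' * d + 2 * ρ := by
      rw [hsplit]
      have := norm_add₃_le (a := (y (τ u) - y i) - d • A (v u)) (b := (y' (τ u) - y' i) - (y (τ u) - y i))
        (c := (d - nearestDist y' i) • A (v u))
      have h4 := hres u
      rw [hn3] at this
      linarith
    have hkey : η' * d + 2 * ρ ≤ (η' * d + 2 * ρ) / (d - ρ) * nearestDist y' i := by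
      rw [div_mul_eq_mul_div, le_div_iff₀ (sub_pos.2 hρd)]
      have hnum : 0 ≤ η' * d + 2 * ρ := by positivity
      exact mul_le_mul_of_nonneg_left hd'lo hnum
    exact hbound.trans hkey
  · -- the nearest-neighbour pinning clauses at `y'` hold for `d' = nn'_i` by definition
    have := nearestDist_le_dist y' ha
    rwa [dist_comm] at this
  · obtain ⟨k, hk, heq⟩ := exists_nearestDist_eq_dist y' ⟨a₀, ha₀⟩
    exact ⟨k, hk, by rw [dist_comm, ← heq]⟩
  · -- the clean gap, with margin `γ − 23/10·ρ`
    by_cases hfa : 13 / 10 * d + γ ≤ dist (y a) (y i)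
    · have := hfar a ha hfa
      exfalso
      linarith
    · push Not at hfa
      have hdisp := dist_perturb (hnear a hfa)
      obtain ⟨h1, hmem⟩ := hgap a ha hfa
      exact ⟨by linarith [hdisp.2], hmem⟩

/-- ★ The collar for `GoodWith` (both patterns lie on the unit sphere). [folklore] -/
theorem GoodWith.perturb {D D' : ℝ} {N : ℕ} {y y' : Fin N → E3} {i : Fin N} {d η' γ ρ : ℝ}
    (h : GoodWith D y i d η' γ) (hη0 : 0 ≤ η') (hη3 : η' < 3 / 10) (hρ0 : 0 ≤ ρ) (hργ : 23 / 10 * ρ < γ) (hρd : ρ < d) (hD : d + ρ ≤ D')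
    (hnear : ∀ a, dist (y a) (y i) < 13 / 10 * d + γ → ‖(y' a - y' i) - (y a - y i)‖ ≤ ρ)
    (hfar : ∀ a, a ≠ i → 13 / 10 * d + γ ≤ dist (y a) (y i) → 13 / 10 * d + γ - ρ ≤ dist (y' a) (y' i)) :
    (∀ a, a ≠ i → y' a ≠ y' i) ∧ GoodWith D' y' i (nearestDist y' i) ((η' * d + 2 * ρ) / (d - ρ)) (γ - 23 / 10 * ρ) := by
  obtain ⟨-, hor⟩ := h
  rcases hor with hf | hh
  · have hv : ∀ u : ↥fccKissingPattern, ‖(u : E3)‖ = 1 := fun u => norm_eq_one_of_mem_fccKissingPattern u.2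
    obtain ⟨-, hhi, hoff, hfit⟩ := hf.perturb hv hη0 hη3 hρ0 hργ hρd hnear hfar
    exact ⟨hoff, hhi.trans hD, Or.inl hfit⟩
  · have hv : ∀ u : ↥hcpKissingPattern, ‖(u : E3)‖ = 1 := fun u => norm_eq_one_of_mem_hcpKissingPattern u.2
    obtain ⟨-, hhi, hoff, hfit⟩ := hh.perturb hv hη0 hη3 hρ0 hργ hρd hnear hfar
    exact ⟨hoff, hhi.trans hD, Or.inr hfit⟩

/-! ## §3. The collar in the tree's currency -/

/-- ★★ **GOOD COLLAR**: goodness with exposed parameters `(d, η', γ)` at `y`, displacements `≤ ρ` relative to the centre, and the margin law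
`η'·d + 2ρ < ηmax·(d − ρ)` (with `ρ < d`, `23/10·ρ < γ`, `d + ρ ≤ D'`, `ηmax ≤ 3/10`) give `GoodAtScale ηmax D' y' i`. [folklore] -/
theorem goodAtScale_of_goodWith_perturb {D D' ηmax : ℝ} {N : ℕ} {y y' : Fin N → E3} {i : Fin N} {d η' γ ρ : ℝ}
    (h : GoodWith D y i d η' γ) (hη0 : 0 ≤ η') (hρ0 : 0 ≤ ρ) (hρd : ρ < d) (hργ : 23 / 10 * ρ < γ) (hD : d + ρ ≤ D')
    (hηmax : ηmax ≤ 3 / 10) (hmargin : η' * d + 2 * ρ < ηmax * (d - ρ))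
    (hnear : ∀ a, dist (y a) (y i) < 13 / 10 * d + γ → ‖(y' a - y' i) - (y a - y i)‖ ≤ ρ)
    (hfar : ∀ a, a ≠ i → 13 / 10 * d + γ ≤ dist (y a) (y i) → 13 / 10 * d + γ - ρ ≤ dist (y' a) (y' i)) :
    GoodAtScale ηmax D' y' i := by
  have hd : 0 < d := lt_of_le_of_lt hρ0 hρd
  have hη3 : η' < 3 / 10 := by
    have h1 : ηmax * (d - ρ) ≤ 3 / 10 * (d - ρ) := mul_le_mul_of_nonneg_right hηmax (sub_nonneg.2 hρd.le)
    have h2 : η' * d < 3 / 10 * d := by nlinarith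
    exact lt_of_mul_lt_mul_right h2 hd.le
  obtain ⟨hoff, hgw⟩ := h.perturb hη0 hη3 hρ0 hργ hρd hD hnear hfar
  refine hgw.goodAtScale hoff ?_
  rw [div_lt_iff₀ (sub_pos.2 hρd)]
  exact hmargin

/-- ★★ Corollary — GLOBAL SHIFT: every atom moved `≤ ρ` relative to the centre (the shape of a shuffle move `ξ₀ ↦ ξ` of the homogeneous
two-sublattice cluster at fixed cell matrix `U`: B-atoms move by `U(ξ − ξ₀)`, A-atoms stay). [folklore] -/
theorem goodAtScale_of_goodWith_shift {D D' ηmax : ℝ} {N : ℕ} {y y' : Fin N → E3} {i : Fin N} {d η' γ ρ : ℝ}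
    (h : GoodWith D y i d η' γ) (hη0 : 0 ≤ η') (hρ0 : 0 ≤ ρ) (hρd : ρ < d) (hργ : 23 / 10 * ρ < γ) (hD : d + ρ ≤ D')
    (hηmax : ηmax ≤ 3 / 10) (hmargin : η' * d + 2 * ρ < ηmax * (d - ρ)) (hρ : ∀ a, ‖(y' a - y' i) - (y a - y i)‖ ≤ ρ) :
    GoodAtScale ηmax D' y' i :=
  goodAtScale_of_goodWith_perturb h hη0 hρ0 hρd hργ hD hηmax hmargin (fun a _ => hρ a) fun a _ hfa => by
    have := (dist_perturb (hρ a)).1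
    linarith

/-! ## §4. The dilation CONE: exact scale covariance of the fit predicate -/

/-- The point-set clause list is covariant under a dilation `y ↦ λ·y` (`λ > 0`): scale `λd`, template `λt`, margin `λγ`, same rotation and
residual level (pattern-generic). [folklore] -/
theorem clauses_smul {P : Type*} (v : P → E3) {N : ℕ} {y : Fin N → E3} {i : Fin N} {d η' ηmax γ c : ℝ} (hc : 0 < c)
    {A : E3 →ₗᵢ[ℝ] E3} {t : P → E3}
    (h : 0 < d ∧ 0 < γ ∧ η' < ηmax ∧ (∀ u, t u ∈ Set.range y ∧ ‖(t u - y i) - d • A (v u)‖ ≤ η' * d) ∧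
      (∀ s, s ∈ Set.range y → s ≠ y i → d ≤ dist s (y i)) ∧ (∃ s, s ∈ Set.range y ∧ s ≠ y i ∧ dist s (y i) ≤ d) ∧
      (∀ s, s ∈ Set.range y → s ≠ y i → dist s (y i) < 13 / 10 * d + γ → dist s (y i) ≤ 13 / 10 * d - γ ∧ s ∈ Set.range t)) :
    0 < c * d ∧ 0 < c * γ ∧ η' < ηmax ∧
      (∀ u, c • t u ∈ Set.range (fun a => c • y a) ∧ ‖(c • t u - (fun a => c • y a) i) - (c * d) • A (v u)‖ ≤ η' * (c * d)) ∧
      (∀ s, s ∈ Set.range (fun a => c • y a) → s ≠ (fun a => c • y a) i → c * d ≤ dist s ((fun a => c • y a) i)) ∧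
      (∃ s, s ∈ Set.range (fun a => c • y a) ∧ s ≠ (fun a => c • y a) i ∧ dist s ((fun a => c • y a) i) ≤ c * d) ∧
      (∀ s, s ∈ Set.range (fun a => c • y a) → s ≠ (fun a => c • y a) i → dist s ((fun a => c • y a) i) < 13 / 10 * (c * d) + c * γ →
        dist s ((fun a => c • y a) i) ≤ 13 / 10 * (c * d) - c * γ ∧ s ∈ Set.range (fun u => c • t u)) := by
  obtain ⟨hd, hγ, hη, ht, hnn₁, ⟨s₀, ⟨a₀, rfl⟩, hs₀, hs₀d⟩, hgap⟩ := h
  have hcn : ‖c‖ = c := by rw [Real.norm_eq_abs, abs_of_pos hc]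
  have hdist : ∀ a, dist (c • y a) (c • y i) = c * dist (y a) (y i) := fun a => by rw [dist_smul₀, hcn]
  have hne : ∀ a, c • y a ≠ c • y i → y a ≠ y i := fun a h h' => h (by rw [h'])
  refine ⟨mul_pos hc hd, mul_pos hc hγ, hη, fun u => ⟨?_, ?_⟩, ?_, ⟨c • y a₀, ⟨a₀, rfl⟩, ?_, ?_⟩, ?_⟩
  · obtain ⟨a, ha⟩ := (ht u).1
    exact ⟨a, by simp only [ha]⟩
  · have hid : (c • t u - c • y i) - (c * d) • A (v u) = c • ((t u - y i) - d • A (v u)) := by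
      rw [smul_sub, smul_sub, mul_smul]
    rw [show (fun a => c • y a) i = c • y i from rfl, hid, norm_smul, hcn, show η' * (c * d) = c * (η' * d) by ring]
    exact mul_le_mul_of_nonneg_left (ht u).2 hc.le
  · rintro s ⟨a, rfl⟩ hs
    simp only at hs ⊢
    rw [hdist]
    exact mul_le_mul_of_nonneg_left (hnn₁ (y a) ⟨a, rfl⟩ (hne a hs)) hc.le
  · intro h
    exact hs₀ (smul_right_injective E3 hc.ne' h)
  · simp only
    rw [hdist]
    exact mul_le_mul_of_nonneg_left hs₀d hc.le
  · rintro s ⟨a, rfl⟩ hs hlt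
    simp only at hs hlt ⊢
    rw [hdist] at hlt ⊢
    have hlt' : dist (y a) (y i) < 13 / 10 * d + γ := by nlinarith
    obtain ⟨h1, ⟨u, hu⟩⟩ := hgap (y a) ⟨a, rfl⟩ (hne a hs) hlt'
    exact ⟨by nlinarith, ⟨u, by simp only [hu]⟩⟩

/-- ★ **DILATION CONE**: `GoodAtScale η D y i → GoodAtScale η (λ·D) (λ·y) i` for `λ > 0` — the fit predicate is EXACTLY scale covariant.
For the homogeneous two-sublattice cluster, `cluster (λU) ξ = λ · cluster U ξ` with the SAME shuffle `ξ`, so ONE goodness certificate on a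
cell-matrix box `B` certifies the goodness-only core of every column whose cell matrices lie in the cone `{λU : U ∈ B, λ > 0}` (cap permitting):
the columns along the dilation direction `(1,1,1,0,0,0)` share their core certificate (memo §5 «ConeString»). [folklore] -/
theorem goodAtScale_smul {ηmax D c : ℝ} (hc : 0 < c) {N : ℕ} {y : Fin N → E3} {i : Fin N} (h : GoodAtScale ηmax D y i) :
    GoodAtScale ηmax (c * D) (fun a => c • y a) i := by
  obtain ⟨d, η', γ, A, hdD, hor⟩ := h
  refine ⟨c * d, η', c * γ, A, mul_le_mul_of_nonneg_left hdD hc.le, ?_⟩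
  rcases hor with ⟨t, hcl⟩ | ⟨t, hcl⟩
  · exact Or.inl ⟨fun u => c • t u, clauses_smul (fun u : ↥fccKissingPattern => (u : E3)) hc hcl⟩
  · exact Or.inr ⟨fun u => c • t u, clauses_smul (fun u : ↥hcpKissingPattern => (u : E3)) hc hcl⟩

end Summit.AtomisticToContinuum.Crystallization.Theorems.FrustratedLawDichotomyStrainedPatchHomGoodCollar
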